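import Summits.QuantumFields.YangMills.Theorems.BalabanUVNodesN11TStepGenOpJunction

/-!
# DAG node N11 — (O3′) ON THE NOSE, SUMMED OVER THE `{S_j}`-INDEX OF RECORD, MODULO THE CHARTED INNER IDENTIFICATION: the branch-sum edition of the `genOp`
# junction, the canonical configuration family, `𝐓_{k+1}(s′)` as the sum of generations of record, un-presentation

HEADER — WORK-UNIT METADATA.  Cell `pub-ymgap`, YM-PLAN Track A (HUMAN RULING D-0062), seat `pub-ymgap-dag-n11-d` (g15; R134 fan-out base seat N11 [B14], strategy s2),
route `BalabanUVNodes` rev 27, item K1⁸ `StabilityBRunRowsAtRecordR13SepCoPH` = stmt-QuantumFields-26907 (helper lane, `--kind proof --supports 26907 --as helper`,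
count-neutral).  [III] = [Balaban1988Convergent].  Sequel of this seat's `…N11TStepGenOpJunction` (p617211: ★★★★★ `tstepOfRecord_comp_glue_ae_eq_genOp_genDataOfRecord` — def-T's
value-level T-step (†) through the bond-partition presentation `e_α` is 11a's ONE generation `genOp k (genDataOfRecord … s′ S k) Φ (ωOf q)` for ONE branch, modulo the inner
reading `hin` and the inner identification on the averaging fibre `hinner`) and `…N11TStepOfRecordSeparated` (p616225), over 11a `Node00/TkOfRecord` (`TkOfRecord_apply`,
`tkBranchOfRecord_succ`, `genOp_apply`, `vOp_apply`, `kernelRT_apply` — all `rfl`) and `Node00/Sect2FormOfRecord` (`sect2Slot … s t E U := TkOfRecord … (sect2Operand …)`).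
Bus: CLAIM-1 = INTENT-1 of g15.

WHY THIS FILE.  The RIGHT side of N11's (O3′) (`…N11Sect3SupplyChainDefs.PresentChildObligations`, last conjunct) is `sect2Slot (k+1) s′ t E U = 𝐓_{k+1}(s′)[W] e^{A_{k+1}(s′; t, E, U)}`
= 11a's `TkOfRecord … (k+1) s′ Φ`, which is — by `TkOfRecord_apply` and (3.24) `tkBranchOfRecord_succ` — the SUM over the `{S_j}`-index of record `admSOfRecord … (k+1) s′` of the
generations `genOp k (genDataOfRecord … W s′ S k)` applied to the old branch operators `𝐓_k(s′, S)Φ_S`, read at the base configuration of `V′` (§1 `TkOfRecord_succ_eq_sum_genOp`, every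
history).  p617211 put the LEFT side through the presentation in the normal form of ONE such generation.  So (O3′) closes BY NAME as soon as the charted inner reading `Fᵢ` SPLITS
over a finite family of generations on the averaging fibre — the displayed SUMMED inner identification `hinnerSum` of §2 (where the chart seats' Jacobian ∕ gauge fixing ∕ `ζ` ∕ `aOp`
identification AND [III] Thm 2's re-expansion of the new small-field integral into `exp A_{k+1}` live; DISPLAYED, not proved) — with the CANONICAL configuration family
`ωOf q := baseCfg (k+1) (e_α q)` (§1: p617211's pin `hω` DISCHARGED) and 11a's restricted transport additive over the finite sum (§1).  §3 removes the presentation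
(`e_α` presents `dV′`, dag-n11-e's `measurePreserving_piEquivPiSubtypeProd_symm_fieldMeasure`): the identity of (O3′) holds `dV′`-a.e. ON THE NOSE.

WHAT THIS FILE PROVES (0 `def`, 0 `sorry`, standard axioms).
§1 11a BOOKKEEPING — `integrable_condLaw_of_measurable_bounded` (a bounded measurable function of the inside fine variables is integrable against the restricted conditional
   law at EVERY coarse point) · ★ `kernelRTOfRecord_finset_sum_apply` (11a's restricted transport of record is additive over finite sums of conditionally integrable
   integrands, at the point) · ★ `baseCfg_succ_comp_glue_pinned` (the canonical family `q ↦ baseCfg (k+1) (e_α q)` has scale-`(k+1)` gauge component `q.1` on `sV'` —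
   p617211's `hω`) · ★ `genOp_genDataOfRecord_eq_kernelRTOfRecord_of_pinned` (one generation of record at a pinned family IS the restricted transport of record of the
   explicit integrand `y ↦ ζ(ω_y)·(aOp … Φ)(ω_y)` at `q.1`) · ★★ `TkOfRecord_succ_eq_sum_genOp` (`𝐓_{k+1}(s′)Φ (V′) = Σ_{S ∈ admSOfRecord (k+1) s′} genOp k (genDataOfRecord … s′ S k)
   (𝐓_k(s′,S)Φ_S) (baseCfg (k+1) V′)`, EVERY history — not only `Ω_{k+1} = ∅`).
§2 ★★★★★ `tstepOfRecord_comp_glue_ae_eq_sum_genOp` — BRANCH-SUM EDITION of p617211 §2: for a finite family `i ↦ (W_i, S_i, Φ_i)` and any family `ωOf` pinned at scale `k+1`,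
   `(tstepOfRecord … k T s′) ∘ e_α =ᵐ q ↦ Σ_i genOp k (genDataOfRecord … W_i s′ S_i k) Φ_i (ωOf q)` MODULO `hG` ∕ `hin` (p616225), per-summand conditional integrability `hint`
   and the SUMMED inner identification `hinnerSum`; ★★★★★ `slotsTOfRecord_succ_comp_glue_ae_eq_TkOfRecord_succ` — at `i := S ∈ admSOfRecord (k+1) s′`, `Φ_S := 𝐓_k(s′,S)Φ_S`,
   canonical `ωOf`: `(slotsTOfRecord … (k+1) s′) ∘ e_α =ᵐ (TkOfRecord … W (k+1) s′ Φ) ∘ e_α`.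
§3 UN-PRESENTATION — `ae_eq_of_comp_glue_ae_eq` (`f ∘ e_α =ᵐ[Π Haar ⊗ Π Haar] g ∘ e_α → f =ᵐ[fieldMeasure] g`) · ★★★★★★ `slotsTOfRecord_succ_ae_eq_TkOfRecord_succ_of_innerSum`
   (`slotsTOfRecord … (k+1) s′ =ᵐ[fieldMeasure (F.P K) (k+1) (SU N)] TkOfRecord … W (k+1) s′ Φ` — at `Φ := sect2Operand … s′ t E U` the right side IS `sect2Slot … W s′ t E U`
   (`rfl`): THE IDENTITY OF (O3′) ON THE NOSE for ANY proposed witness `(t, E, U)` and weights `W`, modulo `hG`, `hin`, `hint`, `hinnerSum`).  The editions in the Stage-13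
   letters of `PresentChildObligations` (weights `WtOfRecord₁₃H θ p s′`, background `UbgOfRecord₁₃CoP … (k+1) s′`) follow in the sequel file `…N11TStepBranchSumAtRecord13`.

HONEST FRAMING.  Helper lane of K1⁸; count-neutral; kernel bookkeeping BY NAME over def-T's ∕ 11a's definitions (additivity of an integral against a Markov kernel, `Finset.sum`
algebra, a measure-preserving equivalence); `hG` ∕ `hin` ∕ `hint` ∕ `hinnerSum` are DISPLAYED hypotheses (no claim that the canonical family or any weights satisfy `hinnerSum`); NO chart
of Bałaban's, NO Jacobian, NO Gaussian integration, nothing of [I] §2 ∕ [III] §3 ∕ Thm 2 asserted; (B4) ∕ (S-α) ∕ (O3′) NOT closed; N11 NOT discharged; K1⁸ NOT closed, no registered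
stub touched; counts unmoved (typed 28∕28 · discharged 5∕27 · A 5∕28).  One finite `𝕋⁴_{L^K}` programme at fixed `ε = L^{−K}`; R4 closes only the conditional finite-𝕋⁴ rung
`BalabanLadder.UV` — NOT ℝ⁴, NOT OS, NOT a mass gap, NOT Clay.  No `sorry`, `axiom`, `def`, `instance`, `notation`.  Sources (SHAPE ∕ bookkeeping only): [III] (2.1) p.254,
(2.18) p.257, (2.20)–(2.21) p.258, (2.23) p.258, (3.1) p.264, (3.24)–(3.25) p.270, §3 p.279.
-/

noncomputable section

open MeasureTheory ProbabilityTheory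
open scoped ENNReal NNReal BigOperators

namespace Summit.QuantumFields.YangMills.Theorems.BalabanUVNodesN11TStepBranchSum

open Literature.MathematicalPhysics.QuantumFieldTheory.Balaban1983to89
open Literature.MathematicalPhysics.QuantumFieldTheory.Balaban1983to89.T4AveragingDisintegration
open BalabanUVNodesN11TStepOfRecordSeparated (tstepOfRecord_comp_glue_ae_eq_kernelRTOfRecord_bondsIn)
open BalabanUVNodesN11TStepGenOpJunction (kernelRTOfRecord_congr_of_fibre_ae_prod)
open BalabanUVNodesN11AveragingSkewPresentationAtRecord (toFine_mem_compl_Omega_iff)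
open Node00 hiding SU
open Node00.Tk T4Continuum
open B10Eq42TorusConstraint (bondsIn)
open B10Eq38TorusDomains (toFine)

variable {F : T4Family} {N : ℕ} [NeZero N]

/-! ## §1  11a bookkeeping: conditional integrability, additivity of the restricted transport, the canonical pinned family, one generation as a restricted transport,
`𝐓_{k+1}(s′)` as the sum of generations of record -/

section Bookkeeping

/-- A BOUNDED MEASURABLE function of the inside fine variables is integrable against 11a's restricted conditional law (`condLaw` of product Haar along `avgRestrOfRecord`)
at EVERY coarse point — the conditional law is a Markov kernel. [cite: Balaban1988Convergent, (2.21) p.258 (bookkeeping)] -/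
theorem integrable_condLaw_of_measurable_bounded (K k : ℕ) [DecidableEq (PBond (F.P K) k)] (sV : Finset (PBond (F.P K) k)) (sV' : Finset (PBond (F.P K) (k + 1)))
    {f : (↥sV → SU N) → ℝ} (hf : Measurable f) {C : ℝ} (hC : ∀ y, |f y| ≤ C) (y' : ↥sV' → SU N) :
    Integrable f (condLaw (Measure.pi fun _ : ↥sV => (HaarData.haar : Measure (SU N))) (avgRestrOfRecord F N K k sV sV') y') := by
  refine Integrable.of_bound hf.aestronglyMeasurable C (Filter.Eventually.of_forall fun y => ?_)
  rw [Real.norm_eq_abs]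
  exact hC y

/-- ★ **11a's RESTRICTED TRANSPORT OF RECORD IS ADDITIVE OVER FINITE SUMS** of integrands integrable against the restricted conditional law at the coarse point `y′`
(`integral_finset_sum` inside `kernelRT`; the marginal density factors out). [cite: Balaban1988Convergent, (2.18) p.257, (2.21) p.258 (bookkeeping)] -/
theorem kernelRTOfRecord_finset_sum_apply (K k : ℕ) [DecidableEq (PBond (F.P K) k)] (sV : Finset (PBond (F.P K) k)) (sV' : Finset (PBond (F.P K) (k + 1)))
    {I : Type*} (ι : Finset I) (f : I → (↥sV → SU N) → ℝ) (y' : ↥sV' → SU N)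
    (hf : ∀ i ∈ ι, Integrable (f i) (condLaw (Measure.pi fun _ : ↥sV => (HaarData.haar : Measure (SU N))) (avgRestrOfRecord F N K k sV sV') y')) :
    kernelRTOfRecord F N K k sV sV' (fun y => ∑ i ∈ ι, f i y) y' = ∑ i ∈ ι, kernelRTOfRecord F N K k sV sV' (f i) y' := by
  show kernelTransport _ _ _ (fun y => ∑ i ∈ ι, f i y) y' = ∑ i ∈ ι, kernelTransport _ _ _ (f i) y'
  simp only [kernelTransport]
  rw [integral_finsetSum ι hf, Finset.mul_sum]

variable {V : Type} [NormedAddCommGroup V] [InnerProductSpace ℝ V] [FiniteDimensional ℝ V] [MeasurableSpace V] [BorelSpace V]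

omit [NeZero N] [InnerProductSpace ℝ V] [FiniteDimensional ℝ V] [MeasurableSpace V] [BorelSpace V] in
/-- ★ **THE CANONICAL CONFIGURATION FAMILY IS PINNED**: `ωOf q := baseCfg (k+1) (e_α q)` — the base configuration of the presented coarse field — has scale-`(k+1)` gauge
component `q.1` on the inside bond set `sV'` (p617211's hypothesis `hω` for this family): `baseCfg`'s `dif_pos rfl` and `Equiv.piEquivPiSubtypeProd_symm_apply`.
[cite: Balaban1988Convergent, (2.18) p.257, (2.21) p.258 (bookkeeping)] -/
theorem baseCfg_succ_comp_glue_pinned (K k : ℕ) [DecidableEq (PBond (F.P K) (k + 1))] (sV' : Finset (PBond (F.P K) (k + 1)))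
    (q : (↥sV' → SU N) × ({c : PBond (F.P K) (k + 1) // c ∉ sV'} → SU N)) :
    (fun b : ↥sV' => ((baseCfg (V := V) (k + 1)
        ((MeasurableEquiv.piEquivPiSubtypeProd (fun _ : PBond (F.P K) (k + 1) => SU N) (· ∈ sV')).symm q)) (k + 1)).1 (b : PBond (F.P K) (k + 1))) = q.1 := by
  funext b
  rw [baseCfg_fst_self]
  show (Equiv.piEquivPiSubtypeProd (· ∈ sV') (fun _ : PBond (F.P K) (k + 1) => SU N)).symm q (b : PBond (F.P K) (k + 1)) = q.1 b
  rw [Equiv.piEquivPiSubtypeProd_symm_apply, dif_pos b.2]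

/-- ★ **ONE GENERATION OF RECORD AT A PINNED CONFIGURATION FAMILY IS THE RESTRICTED TRANSPORT OF RECORD OF THE EXPLICIT INTEGRAND**: for `ωOf` with scale-`(k+1)` gauge
component `q.1` on the inside bonds (`hω`), `genOp k (genDataOfRecord … W s′ S k) Φ (ωOf q) = kernelRTOfRecord … sV sV' (y ↦ ζ_k(Ω^c_{k+1})(ω_y) · (aOp k sA w Φ)(ω_y)) q.1` with
`ω_y := update (ωOf q) k (updateFinset ((ωOf q) k).1 sV y, ((ωOf q) k).2)` (`genOp_apply`, `vOp_apply`, `hω`). [cite: Balaban1988Convergent, (2.21) p.258 (bookkeeping)] -/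
theorem genOp_genDataOfRecord_eq_kernelRTOfRecord_of_pinned (ν : Stage7Numerics) (M : ℕ) (g : ℕ → ℝ) (K : ℕ) (W : TkWeights F N V K) {k : ℕ}
    [DecidableEq (PBond (F.P K) k)] (s' : SeqOfRecord F ν M g K (k + 1)) (S : ℕ → Set (Site (F.P K) 0)) (Φ : MultiCfg (F.P K) (SU N) V → ℝ)
    {Q : Type*} (ωOf : Q → MultiCfg (F.P K) (SU N) V) (π : Q → (↥(Set.toFinite (bondsIn (k + 1) (s'.Ω (k + 1))ᶜ)).toFinset → SU N))
    (hω : ∀ q, (fun b : ↥(Set.toFinite (bondsIn (k + 1) (s'.Ω (k + 1))ᶜ)).toFinset => ((ωOf q) (k + 1)).1 (b : PBond (F.P K) (k + 1))) = π q) (q : Q) :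
    genOp k (genDataOfRecord F N V ν M g K W s' S k) Φ (ωOf q) =
      kernelRTOfRecord F N K k (Set.toFinite (bondsIn k (s'.Ω (k + 1))ᶜ)).toFinset (Set.toFinite (bondsIn (k + 1) (s'.Ω (k + 1))ᶜ)).toFinset
        (fun y => zetaOp (genDataOfRecord F N V ν M g K W s' S k).ζ
          (aOp k (genDataOfRecord F N V ν M g K W s' S k).sA (genDataOfRecord F N V ν M g K W s' S k).w Φ)
          (Function.update (ωOf q) k
            (Function.updateFinset ((ωOf q) k).1 (Set.toFinite (bondsIn k (s'.Ω (k + 1))ᶜ)).toFinset y, ((ωOf q) k).2)))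
        (π q) := by
  rw [genOp_apply, vOp_apply, ← hω q]
  rfl

/-- ★★ **`𝐓_{k+1}(s′)` IS THE SUM OF THE GENERATIONS OF RECORD APPLIED TO THE OLD BRANCH OPERATORS** — EVERY history `s′` (expansion steps included): `(𝐓_{k+1}(s′)Φ)(V′) =
Σ_{S ∈ admSOfRecord (k+1) s′} genOp k (genDataOfRecord … s′ S k) (𝐓_k(s′,S)Φ_S) (baseCfg (k+1) V′)` — `TkOfRecord_apply` and (3.24) `tkBranchOfRecord_succ` under the sum.
(This lineage's `TkOfRecord_succ_eq_sum_genOp_of_Omega_empty` is the special case `Ω_{k+1} = ∅`, where the index collapses to the old one.)  The decidability instance on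
level-`k` bonds is a unifiable implicit `hdec` (11a's `tkBranchOfRecord` reads the classical one; the tree also carries a constructive `instDecidableEqPBond` — both are served).
[cite: Balaban1988Convergent, (2.18) p.257, (2.20)–(2.21) p.258, (3.24) p.270] -/
theorem TkOfRecord_succ_eq_sum_genOp (ν : Stage7Numerics) (M : ℕ) (g : ℕ → ℝ) (K : ℕ) (W : TkWeights F N V K) {k : ℕ} {hdec : DecidableEq (PBond (F.P K) k)}
    (s' : SeqOfRecord F ν M g K (k + 1)) (Φ : SFluct (F.P K) V → B15DeterminingSets.MSField (F.P K) (SU N) → ℝ) (V' : GaugeField (F.P K) (k + 1) (SU N)) :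
    TkOfRecord F N V ν M g K W (k + 1) s' Φ V' =
      ∑ S ∈ admSOfRecord F ν M g K (k + 1) s',
        genOp k (genDataOfRecord F N V ν M g K W s' S k)
          (tkBranchOfRecord F N V ν M g K W s' S k (fun ω => Φ (S, fun j => (ω j).2) (fun j => (ω j).1))) (baseCfg (k + 1) V') := by
  obtain rfl : hdec = fun a b => Classical.propDecidable (a = b) := Subsingleton.elim _ _
  rw [TkOfRecord_apply]
  exact Finset.sum_congr rfl fun S _ => congrFun (tkBranchOfRecord_succ F N V ν M g K W s' S k _) _

end Bookkeeping

/-! ## §2  The branch-sum junction: (†) ∕ the pre-𝐑 slot through the presentation = a finite SUM of generations of record, modulo the summed inner identification -/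

section BranchSum

variable {V : Type} [NormedAddCommGroup V] [InnerProductSpace ℝ V] [FiniteDimensional ℝ V] [MeasurableSpace V] [BorelSpace V]

/-- ★★★★★ **def-T's VALUE-LEVEL T-STEP (†), THROUGH THE BOND-PARTITION PRESENTATION AT `Y = (Ω_{k+1}(s′))ᶜ`, IS A FINITE SUM OF 11a's GENERATIONS OF RECORD AT A PINNED
CONFIGURATION FAMILY** — the BRANCH-SUM EDITION of p617211's `tstepOfRecord_comp_glue_ae_eq_genOp_genDataOfRecord`: for any level-`k` slot family `T`, a finite family
`i ↦ (W_i, S_i, Φ_i)` of 𝐓-weights ∕ branches ∕ operands and any configuration family `ωOf` pinned at scale `k+1` (`hω`), under def-T's integrability of the graph integrand `hG`,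
the displayed inner reading `hin` (p616225), the per-summand integrability `hint` of the explicit inside integrands against the restricted conditional law at `q.1`, and the
DISPLAYED SUMMED INNER IDENTIFICATION ON THE AVERAGING FIBRE `hinnerSum` (on `avgRestrOfRecord⁻¹{q.1}`, the inner reading `Fᵢ (y, q.2)` IS `Σ_i ζ_i(ω_y)·(aOp k sA_i w_i Φ_i)(ω_y)`):
`(tstepOfRecord … k T s′) ∘ e_α =ᵐ[Π_{sV'} Haar ⊗ Π_{sV'ᶜ} Haar] q ↦ Σ_i genOp k (genDataOfRecord F N V ν M g K W_i s′ S_i k) Φ_i (ωOf q)`.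
Proof: p616225 `_bondsIn`, the fibre congruence (p617211 §1) fed `hinnerSum`, additivity (§1), and §1's one-generation normal form per summand.  `hinnerSum` is where [I] §2's change of
variables, its Jacobian, the gauge fixing, `ζ`, `aOp` AND [III] Thm 2's re-expansion live — NOT proved here. [cite: Balaban1988Convergent, (2.18) p.257, (2.20)–(2.21) p.258, (3.1) p.264, (3.24)–(3.25) p.270, §3 p.279] -/
theorem tstepOfRecord_comp_glue_ae_eq_sum_genOp (ν : Stage7Numerics) (M : ℕ) (w : StepWeightsOfRecord F N ν M) (p : B12.RunParams) (g : ℕ → ℝ)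
    {k : ℕ} (hkK : k < p.K) [DecidableEq (PBond (F.P p.K) k)] [DecidableEq (PBond (F.P p.K) (k + 1))] (hk : k + 1 ≤ (F.P p.K).m + (F.P p.K).K)
    (T : SeqOfRecord F ν M g p.K k → Density (F.P p.K) k (SU N)) (s' : SeqOfRecord F ν M g p.K (k + 1))
    (hG : Integrable (fun U => w p g k s' U ((avOfRecord F N p.K k).avg U) * (chiSeqOfRecord F N ν M g p.K k s'.init U * T s'.init U))
      (fieldMeasure (F.P p.K) k (SU N)))
    {Fᵢ : (↥(Set.toFinite (bondsIn k (s'.Ω (k + 1))ᶜ)).toFinset → SU N) ×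
        ({c : PBond (F.P p.K) (k + 1) // c ∉ (Set.toFinite (bondsIn (k + 1) (s'.Ω (k + 1))ᶜ)).toFinset} → SU N) → ℝ} (hFm : Measurable Fᵢ)
    (hin : kernelTransport
        ((Measure.pi fun _ : ↥(Set.toFinite (bondsIn k (s'.Ω (k + 1))ᶜ)).toFinset => (HaarData.haar : Measure (SU N))).prod
          (Measure.pi fun _ : {b : PBond (F.P p.K) k // b ∉ (Set.toFinite (bondsIn k (s'.Ω (k + 1))ᶜ)).toFinset} => (HaarData.haar : Measure (SU N))))
        ((Measure.pi fun _ : ↥(Set.toFinite (bondsIn k (s'.Ω (k + 1))ᶜ)).toFinset => (HaarData.haar : Measure (SU N))).prod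
          (Measure.pi fun _ : {c : PBond (F.P p.K) (k + 1) // c ∉ (Set.toFinite (bondsIn (k + 1) (s'.Ω (k + 1))ᶜ)).toFinset} =>
            (HaarData.haar : Measure (SU N))))
        (fun q => (q.1, fun c : {c : PBond (F.P p.K) (k + 1) // c ∉ (Set.toFinite (bondsIn (k + 1) (s'.Ω (k + 1))ᶜ)).toFinset} =>
          (avOfRecord F N p.K k).avg
            ((MeasurableEquiv.piEquivPiSubtypeProd (fun _ : PBond (F.P p.K) k => SU N)
              (· ∈ (Set.toFinite (bondsIn k (s'.Ω (k + 1))ᶜ)).toFinset)).symm q) c))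
        ((fun U => w p g k s' U ((avOfRecord F N p.K k).avg U) * (chiSeqOfRecord F N ν M g p.K k s'.init U * T s'.init U)) ∘
          ⇑(MeasurableEquiv.piEquivPiSubtypeProd (fun _ : PBond (F.P p.K) k => SU N)
            (· ∈ (Set.toFinite (bondsIn k (s'.Ω (k + 1))ᶜ)).toFinset)).symm)
      =ᵐ[(Measure.pi fun _ : ↥(Set.toFinite (bondsIn k (s'.Ω (k + 1))ᶜ)).toFinset => (HaarData.haar : Measure (SU N))).prod
          (Measure.pi fun _ : {c : PBond (F.P p.K) (k + 1) // c ∉ (Set.toFinite (bondsIn (k + 1) (s'.Ω (k + 1))ᶜ)).toFinset} =>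
            (HaarData.haar : Measure (SU N)))] Fᵢ)
    {I : Type*} (ι : Finset I) (W : I → TkWeights F N V p.K) (S : I → ℕ → Set (Site (F.P p.K) 0)) (Φ : I → MultiCfg (F.P p.K) (SU N) V → ℝ)
    (ωOf : (↥(Set.toFinite (bondsIn (k + 1) (s'.Ω (k + 1))ᶜ)).toFinset → SU N) ×
        ({c : PBond (F.P p.K) (k + 1) // c ∉ (Set.toFinite (bondsIn (k + 1) (s'.Ω (k + 1))ᶜ)).toFinset} → SU N) → MultiCfg (F.P p.K) (SU N) V)
    (hω : ∀ q, (fun b : ↥(Set.toFinite (bondsIn (k + 1) (s'.Ω (k + 1))ᶜ)).toFinset => ((ωOf q) (k + 1)).1 (b : PBond (F.P p.K) (k + 1))) = q.1)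
    (hint : ∀ᵐ q ∂((Measure.pi fun _ : ↥(Set.toFinite (bondsIn (k + 1) (s'.Ω (k + 1))ᶜ)).toFinset => (HaarData.haar : Measure (SU N))).prod
          (Measure.pi fun _ : {c : PBond (F.P p.K) (k + 1) // c ∉ (Set.toFinite (bondsIn (k + 1) (s'.Ω (k + 1))ᶜ)).toFinset} =>
            (HaarData.haar : Measure (SU N)))),
      ∀ i ∈ ι, Integrable
        (fun y : ↥(Set.toFinite (bondsIn k (s'.Ω (k + 1))ᶜ)).toFinset → SU N =>
          zetaOp (genDataOfRecord F N V ν M g p.K (W i) s' (S i) k).ζ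
            (aOp k (genDataOfRecord F N V ν M g p.K (W i) s' (S i) k).sA (genDataOfRecord F N V ν M g p.K (W i) s' (S i) k).w (Φ i))
            (Function.update (ωOf q) k
              (Function.updateFinset ((ωOf q) k).1 (Set.toFinite (bondsIn k (s'.Ω (k + 1))ᶜ)).toFinset y, ((ωOf q) k).2)))
        (condLaw (Measure.pi fun _ : ↥(Set.toFinite (bondsIn k (s'.Ω (k + 1))ᶜ)).toFinset => (HaarData.haar : Measure (SU N)))
          (avgRestrOfRecord F N p.K k (Set.toFinite (bondsIn k (s'.Ω (k + 1))ᶜ)).toFinset (Set.toFinite (bondsIn (k + 1) (s'.Ω (k + 1))ᶜ)).toFinset) q.1))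
    (hinnerSum : ∀ᵐ q ∂((Measure.pi fun _ : ↥(Set.toFinite (bondsIn (k + 1) (s'.Ω (k + 1))ᶜ)).toFinset => (HaarData.haar : Measure (SU N))).prod
          (Measure.pi fun _ : {c : PBond (F.P p.K) (k + 1) // c ∉ (Set.toFinite (bondsIn (k + 1) (s'.Ω (k + 1))ᶜ)).toFinset} =>
            (HaarData.haar : Measure (SU N)))),
      ∀ y : ↥(Set.toFinite (bondsIn k (s'.Ω (k + 1))ᶜ)).toFinset → SU N,
        avgRestrOfRecord F N p.K k (Set.toFinite (bondsIn k (s'.Ω (k + 1))ᶜ)).toFinset (Set.toFinite (bondsIn (k + 1) (s'.Ω (k + 1))ᶜ)).toFinset y = q.1 →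
        Fᵢ (y, q.2) =
          ∑ i ∈ ι, zetaOp (genDataOfRecord F N V ν M g p.K (W i) s' (S i) k).ζ
            (aOp k (genDataOfRecord F N V ν M g p.K (W i) s' (S i) k).sA (genDataOfRecord F N V ν M g p.K (W i) s' (S i) k).w (Φ i))
            (Function.update (ωOf q) k
              (Function.updateFinset ((ωOf q) k).1 (Set.toFinite (bondsIn k (s'.Ω (k + 1))ᶜ)).toFinset y, ((ωOf q) k).2))) :
    (tstepOfRecord F N ν M w p g k T s') ∘
        ⇑(MeasurableEquiv.piEquivPiSubtypeProd (fun _ : PBond (F.P p.K) (k + 1) => SU N)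
          (· ∈ (Set.toFinite (bondsIn (k + 1) (s'.Ω (k + 1))ᶜ)).toFinset)).symm
      =ᵐ[(Measure.pi fun _ : ↥(Set.toFinite (bondsIn (k + 1) (s'.Ω (k + 1))ᶜ)).toFinset => (HaarData.haar : Measure (SU N))).prod
          (Measure.pi fun _ : {c : PBond (F.P p.K) (k + 1) // c ∉ (Set.toFinite (bondsIn (k + 1) (s'.Ω (k + 1))ᶜ)).toFinset} =>
            (HaarData.haar : Measure (SU N)))]
        fun q => ∑ i ∈ ι, genOp k (genDataOfRecord F N V ν M g p.K (W i) s' (S i) k) (Φ i) (ωOf q) := by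
  have h5 := tstepOfRecord_comp_glue_ae_eq_kernelRTOfRecord_bondsIn ν M w p g hkK hk T s' (toFine_mem_compl_Omega_iff s' hk) hG hFm hin
  have hfib := kernelRTOfRecord_congr_of_fibre_ae_prod (F := F) (N := N) p.K k (Set.toFinite (bondsIn k (s'.Ω (k + 1))ᶜ)).toFinset
    (Set.toFinite (bondsIn (k + 1) (s'.Ω (k + 1))ᶜ)).toFinset
    (Measure.pi fun _ : {c : PBond (F.P p.K) (k + 1) // c ∉ (Set.toFinite (bondsIn (k + 1) (s'.Ω (k + 1))ᶜ)).toFinset} =>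
      (HaarData.haar : Measure (SU N)))
  filter_upwards [h5, hfib, hint, hinnerSum] with q hq hfq hintq hiq
  rw [hq, hfq _ _ hiq, kernelRTOfRecord_finset_sum_apply p.K k _ _ ι _ q.1 hintq]
  exact Finset.sum_congr rfl fun i _ =>
    (genOp_genDataOfRecord_eq_kernelRTOfRecord_of_pinned ν M g p.K (W i) s' (S i) (Φ i) ωOf (fun q => q.1) hω q).symm

/-- ★★★★★ **THE REPRESENTED TOWER's PRE-𝐑 SLOT THROUGH THE PRESENTATION IS 11a's `𝐓_{k+1}(s′)` OF THE OPERAND, THROUGH THE PRESENTATION** — §2 at `T := slotsOfRecord … k`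
(`slotsTOfRecord_succ`), the index `S ∈ admSOfRecord (k+1) s′` with the weights `W` fixed, the operands `𝐓_k(s′,S)Φ_S` (old branch operators of record) and the CANONICAL
family `ωOf q := baseCfg (k+1) (e_α q)` (§1, `hω` discharged); the RIGHT side re-summed by §1's `TkOfRecord_succ_eq_sum_genOp`:
`(slotsTOfRecord … (k+1) s′) ∘ e_α =ᵐ (TkOfRecord F N V ν τ.M g K W (k+1) s′ Φ) ∘ e_α`, modulo `hG`, `hin`, `hint`, `hinnerSum` (stated at these choices).
[cite: Balaban1988Convergent, (2.18) p.257, (2.20)–(2.21) p.258, (3.24)–(3.25) p.270, §3 p.279] -/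
theorem slotsTOfRecord_succ_comp_glue_ae_eq_TkOfRecord_succ (ν : Stage7Numerics) (τ : TowerNumerics) (E : B12.RunParams → ℝ)
    (w : StepWeightsOfRecord F N ν τ.M) (ppSel : PpSelOfRecord F ν τ.M) (p : B12.RunParams) (g : ℕ → ℝ) {k : ℕ} (hkK : k < p.K)
    {hdec : DecidableEq (PBond (F.P p.K) k)} [DecidableEq (PBond (F.P p.K) (k + 1))] (hk : k + 1 ≤ (F.P p.K).m + (F.P p.K).K)
    (s' : SeqOfRecord F ν τ.M g p.K (k + 1)) (W : TkWeights F N V p.K)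
    (Φ : SFluct (F.P p.K) V → B15DeterminingSets.MSField (F.P p.K) (SU N) → ℝ)
    (hG : Integrable (fun U => w p g k s' U ((avOfRecord F N p.K k).avg U) *
      (chiSeqOfRecord F N ν τ.M g p.K k s'.init U * slotsOfRecord F N ν τ E w ppSel p g k s'.init U)) (fieldMeasure (F.P p.K) k (SU N)))
    {Fᵢ : (↥(Set.toFinite (bondsIn k (s'.Ω (k + 1))ᶜ)).toFinset → SU N) ×
        ({c : PBond (F.P p.K) (k + 1) // c ∉ (Set.toFinite (bondsIn (k + 1) (s'.Ω (k + 1))ᶜ)).toFinset} → SU N) → ℝ} (hFm : Measurable Fᵢ)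
    (hin : kernelTransport
        ((Measure.pi fun _ : ↥(Set.toFinite (bondsIn k (s'.Ω (k + 1))ᶜ)).toFinset => (HaarData.haar : Measure (SU N))).prod
          (Measure.pi fun _ : {b : PBond (F.P p.K) k // b ∉ (Set.toFinite (bondsIn k (s'.Ω (k + 1))ᶜ)).toFinset} => (HaarData.haar : Measure (SU N))))
        ((Measure.pi fun _ : ↥(Set.toFinite (bondsIn k (s'.Ω (k + 1))ᶜ)).toFinset => (HaarData.haar : Measure (SU N))).prod
          (Measure.pi fun _ : {c : PBond (F.P p.K) (k + 1) // c ∉ (Set.toFinite (bondsIn (k + 1) (s'.Ω (k + 1))ᶜ)).toFinset} =>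
            (HaarData.haar : Measure (SU N))))
        (fun q => (q.1, fun c : {c : PBond (F.P p.K) (k + 1) // c ∉ (Set.toFinite (bondsIn (k + 1) (s'.Ω (k + 1))ᶜ)).toFinset} =>
          (avOfRecord F N p.K k).avg
            ((MeasurableEquiv.piEquivPiSubtypeProd (fun _ : PBond (F.P p.K) k => SU N)
              (· ∈ (Set.toFinite (bondsIn k (s'.Ω (k + 1))ᶜ)).toFinset)).symm q) c))
        ((fun U => w p g k s' U ((avOfRecord F N p.K k).avg U) *
            (chiSeqOfRecord F N ν τ.M g p.K k s'.init U * slotsOfRecord F N ν τ E w ppSel p g k s'.init U)) ∘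
          ⇑(MeasurableEquiv.piEquivPiSubtypeProd (fun _ : PBond (F.P p.K) k => SU N)
            (· ∈ (Set.toFinite (bondsIn k (s'.Ω (k + 1))ᶜ)).toFinset)).symm)
      =ᵐ[(Measure.pi fun _ : ↥(Set.toFinite (bondsIn k (s'.Ω (k + 1))ᶜ)).toFinset => (HaarData.haar : Measure (SU N))).prod
          (Measure.pi fun _ : {c : PBond (F.P p.K) (k + 1) // c ∉ (Set.toFinite (bondsIn (k + 1) (s'.Ω (k + 1))ᶜ)).toFinset} =>
            (HaarData.haar : Measure (SU N)))] Fᵢ)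
    (hint : ∀ᵐ q ∂((Measure.pi fun _ : ↥(Set.toFinite (bondsIn (k + 1) (s'.Ω (k + 1))ᶜ)).toFinset => (HaarData.haar : Measure (SU N))).prod
          (Measure.pi fun _ : {c : PBond (F.P p.K) (k + 1) // c ∉ (Set.toFinite (bondsIn (k + 1) (s'.Ω (k + 1))ᶜ)).toFinset} =>
            (HaarData.haar : Measure (SU N)))),
      ∀ S ∈ admSOfRecord F ν τ.M g p.K (k + 1) s', Integrable
        (fun y : ↥(Set.toFinite (bondsIn k (s'.Ω (k + 1))ᶜ)).toFinset → SU N =>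
          zetaOp (genDataOfRecord F N V ν τ.M g p.K W s' S k).ζ
            (aOp k (genDataOfRecord F N V ν τ.M g p.K W s' S k).sA (genDataOfRecord F N V ν τ.M g p.K W s' S k).w
              (tkBranchOfRecord F N V ν τ.M g p.K W s' S k (fun ω => Φ (S, fun j => (ω j).2) (fun j => (ω j).1))))
            (Function.update (baseCfg (k + 1) ((MeasurableEquiv.piEquivPiSubtypeProd (fun _ : PBond (F.P p.K) (k + 1) => SU N)
                (· ∈ (Set.toFinite (bondsIn (k + 1) (s'.Ω (k + 1))ᶜ)).toFinset)).symm q)) k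
              (Function.updateFinset ((baseCfg (V := V) (k + 1) ((MeasurableEquiv.piEquivPiSubtypeProd (fun _ : PBond (F.P p.K) (k + 1) => SU N)
                (· ∈ (Set.toFinite (bondsIn (k + 1) (s'.Ω (k + 1))ᶜ)).toFinset)).symm q)) k).1 (Set.toFinite (bondsIn k (s'.Ω (k + 1))ᶜ)).toFinset y,
                ((baseCfg (V := V) (k + 1) ((MeasurableEquiv.piEquivPiSubtypeProd (fun _ : PBond (F.P p.K) (k + 1) => SU N)
                  (· ∈ (Set.toFinite (bondsIn (k + 1) (s'.Ω (k + 1))ᶜ)).toFinset)).symm q)) k).2)))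
        (condLaw (Measure.pi fun _ : ↥(Set.toFinite (bondsIn k (s'.Ω (k + 1))ᶜ)).toFinset => (HaarData.haar : Measure (SU N)))
          (avgRestrOfRecord F N p.K k (Set.toFinite (bondsIn k (s'.Ω (k + 1))ᶜ)).toFinset (Set.toFinite (bondsIn (k + 1) (s'.Ω (k + 1))ᶜ)).toFinset) q.1))
    (hinnerSum : ∀ᵐ q ∂((Measure.pi fun _ : ↥(Set.toFinite (bondsIn (k + 1) (s'.Ω (k + 1))ᶜ)).toFinset => (HaarData.haar : Measure (SU N))).prod
          (Measure.pi fun _ : {c : PBond (F.P p.K) (k + 1) // c ∉ (Set.toFinite (bondsIn (k + 1) (s'.Ω (k + 1))ᶜ)).toFinset} =>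
            (HaarData.haar : Measure (SU N)))),
      ∀ y : ↥(Set.toFinite (bondsIn k (s'.Ω (k + 1))ᶜ)).toFinset → SU N,
        avgRestrOfRecord F N p.K k (Set.toFinite (bondsIn k (s'.Ω (k + 1))ᶜ)).toFinset (Set.toFinite (bondsIn (k + 1) (s'.Ω (k + 1))ᶜ)).toFinset y = q.1 →
        Fᵢ (y, q.2) =
          ∑ S ∈ admSOfRecord F ν τ.M g p.K (k + 1) s', zetaOp (genDataOfRecord F N V ν τ.M g p.K W s' S k).ζ
            (aOp k (genDataOfRecord F N V ν τ.M g p.K W s' S k).sA (genDataOfRecord F N V ν τ.M g p.K W s' S k).w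
              (tkBranchOfRecord F N V ν τ.M g p.K W s' S k (fun ω => Φ (S, fun j => (ω j).2) (fun j => (ω j).1))))
            (Function.update (baseCfg (k + 1) ((MeasurableEquiv.piEquivPiSubtypeProd (fun _ : PBond (F.P p.K) (k + 1) => SU N)
                (· ∈ (Set.toFinite (bondsIn (k + 1) (s'.Ω (k + 1))ᶜ)).toFinset)).symm q)) k
              (Function.updateFinset ((baseCfg (V := V) (k + 1) ((MeasurableEquiv.piEquivPiSubtypeProd (fun _ : PBond (F.P p.K) (k + 1) => SU N)
                (· ∈ (Set.toFinite (bondsIn (k + 1) (s'.Ω (k + 1))ᶜ)).toFinset)).symm q)) k).1 (Set.toFinite (bondsIn k (s'.Ω (k + 1))ᶜ)).toFinset y,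
                ((baseCfg (V := V) (k + 1) ((MeasurableEquiv.piEquivPiSubtypeProd (fun _ : PBond (F.P p.K) (k + 1) => SU N)
                  (· ∈ (Set.toFinite (bondsIn (k + 1) (s'.Ω (k + 1))ᶜ)).toFinset)).symm q)) k).2))) :
    (slotsTOfRecord F N ν τ E w ppSel p g (k + 1) s') ∘
        ⇑(MeasurableEquiv.piEquivPiSubtypeProd (fun _ : PBond (F.P p.K) (k + 1) => SU N)
          (· ∈ (Set.toFinite (bondsIn (k + 1) (s'.Ω (k + 1))ᶜ)).toFinset)).symm
      =ᵐ[(Measure.pi fun _ : ↥(Set.toFinite (bondsIn (k + 1) (s'.Ω (k + 1))ᶜ)).toFinset => (HaarData.haar : Measure (SU N))).prod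
          (Measure.pi fun _ : {c : PBond (F.P p.K) (k + 1) // c ∉ (Set.toFinite (bondsIn (k + 1) (s'.Ω (k + 1))ᶜ)).toFinset} =>
            (HaarData.haar : Measure (SU N)))]
        (TkOfRecord F N V ν τ.M g p.K W (k + 1) s' Φ) ∘
          ⇑(MeasurableEquiv.piEquivPiSubtypeProd (fun _ : PBond (F.P p.K) (k + 1) => SU N)
            (· ∈ (Set.toFinite (bondsIn (k + 1) (s'.Ω (k + 1))ᶜ)).toFinset)).symm := by
  have h := tstepOfRecord_comp_glue_ae_eq_sum_genOp ν τ.M w p g hkK hk (slotsOfRecord F N ν τ E w ppSel p g k) s' hG hFm hin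
    (admSOfRecord F ν τ.M g p.K (k + 1) s') (fun _ => W) (fun S => S)
    (fun S => tkBranchOfRecord F N V ν τ.M g p.K W s' S k (fun ω => Φ (S, fun j => (ω j).2) (fun j => (ω j).1)))
    (fun q => baseCfg (k + 1) ((MeasurableEquiv.piEquivPiSubtypeProd (fun _ : PBond (F.P p.K) (k + 1) => SU N)
      (· ∈ (Set.toFinite (bondsIn (k + 1) (s'.Ω (k + 1))ᶜ)).toFinset)).symm q))
    (baseCfg_succ_comp_glue_pinned p.K k _) hint hinnerSum
  rw [slotsTOfRecord_succ]
  filter_upwards [h] with q hq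
  rw [hq, Function.comp_apply, TkOfRecord_succ_eq_sum_genOp ν τ.M g p.K W (hdec := hdec) s' Φ]

end BranchSum

/-! ## §3  Un-presentation: the identity of (O3′) `dV′`-a.e. ON THE NOSE -/

section OnTheNose

/-- **UN-PRESENTATION**: an a.e. equality of two functions of the coarse field READ THROUGH the bond-partition glue `e_α` (w.r.t. `Π_{sV'} Haar ⊗ Π_{sV'ᶜ} Haar`) is an a.e.
equality w.r.t. `dV′ = fieldMeasure` — the glue's inverse presents `dV′` (dag-n11-e's `measurePreserving_piEquivPiSubtypeProd_fieldMeasure`). [cite: Balaban1988Convergent, (3.1) p.264 (bookkeeping)] -/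
theorem ae_eq_of_comp_glue_ae_eq (K j : ℕ) [DecidableEq (PBond (F.P K) j)] (sV' : Finset (PBond (F.P K) j)) {β : Type*}
    {f f' : GaugeField (F.P K) j (SU N) → β}
    (h : f ∘ ⇑(MeasurableEquiv.piEquivPiSubtypeProd (fun _ : PBond (F.P K) j => SU N) (· ∈ sV')).symm
      =ᵐ[(Measure.pi fun _ : ↥sV' => (HaarData.haar : Measure (SU N))).prod
          (Measure.pi fun _ : {c : PBond (F.P K) j // c ∉ sV'} => (HaarData.haar : Measure (SU N)))]
        f' ∘ ⇑(MeasurableEquiv.piEquivPiSubtypeProd (fun _ : PBond (F.P K) j => SU N) (· ∈ sV')).symm) :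
    f =ᵐ[fieldMeasure (F.P K) j (SU N)] f' := by
  filter_upwards [(measurePreserving_piEquivPiSubtypeProd_fieldMeasure (G := SU N) sV').quasiMeasurePreserving.ae_eq_comp h] with U hU
  simp only [Function.comp_apply, MeasurableEquiv.symm_apply_apply] at hU
  exact hU

variable {V : Type} [NormedAddCommGroup V] [InnerProductSpace ℝ V] [FiniteDimensional ℝ V] [MeasurableSpace V] [BorelSpace V]

/-- ★★★★★★ **THE IDENTITY OF (O3′) ON THE NOSE, MODULO THE CHARTED INNER SUM**: at step `k < K` of the run `p`, for ANY history `s′` of length `k+1` (expansion children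
included), ANY 𝐓-weights `W` and ANY operand `Φ` of r11's shape — under def-T's integrability of the graph integrand `hG`, the displayed inner reading `hin` (p616225), the
per-branch conditional integrability `hint` and the DISPLAYED SUMMED INNER IDENTIFICATION `hinnerSum` over the `{S_j}`-index of record at the canonical configuration family —
THE REPRESENTED TOWER's PRE-𝐑 SLOT IS 11a's `𝐓_{k+1}(s′)` OF THE OPERAND, `dV′`-a.e.:
`slotsTOfRecord … (k+1) s′ =ᵐ[fieldMeasure (F.P K) (k+1) (SU N)] TkOfRecord F N V ν τ.M g K W (k+1) s′ Φ`.
At `Φ := sect2Operand … s′ t E U` the right side IS `sect2Slot … W s′ t E U` (`Node00/Sect2FormOfRecord`, `rfl`) — the identity demanded by the last conjunct of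
`…N11Sect3SupplyChainDefs.PresentChildObligations` (Stage-13 letters: the sequel file).  §2 + §3's un-presentation.  `hinnerSum` carries ALL the mathematics of [I] §2 ∕ [III] §3 ∕
Thm 2 — DISPLAYED, not proved. [cite: Balaban1988Convergent, (2.18) p.257, (2.20)–(2.21) p.258, (2.23) p.258, (3.1) p.264, (3.24)–(3.25) p.270, §3 p.279] -/
theorem slotsTOfRecord_succ_ae_eq_TkOfRecord_succ_of_innerSum (ν : Stage7Numerics) (τ : TowerNumerics) (E : B12.RunParams → ℝ)
    (w : StepWeightsOfRecord F N ν τ.M) (ppSel : PpSelOfRecord F ν τ.M) (p : B12.RunParams) (g : ℕ → ℝ) {k : ℕ} (hkK : k < p.K)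
    {hdec : DecidableEq (PBond (F.P p.K) k)} {hdec' : DecidableEq (PBond (F.P p.K) (k + 1))} (hk : k + 1 ≤ (F.P p.K).m + (F.P p.K).K)
    (s' : SeqOfRecord F ν τ.M g p.K (k + 1)) (W : TkWeights F N V p.K)
    (Φ : SFluct (F.P p.K) V → B15DeterminingSets.MSField (F.P p.K) (SU N) → ℝ)
    (hG : Integrable (fun U => w p g k s' U ((avOfRecord F N p.K k).avg U) *
      (chiSeqOfRecord F N ν τ.M g p.K k s'.init U * slotsOfRecord F N ν τ E w ppSel p g k s'.init U)) (fieldMeasure (F.P p.K) k (SU N)))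
    {Fᵢ : (↥(Set.toFinite (bondsIn k (s'.Ω (k + 1))ᶜ)).toFinset → SU N) ×
        ({c : PBond (F.P p.K) (k + 1) // c ∉ (Set.toFinite (bondsIn (k + 1) (s'.Ω (k + 1))ᶜ)).toFinset} → SU N) → ℝ} (hFm : Measurable Fᵢ)
    (hin : kernelTransport
        ((Measure.pi fun _ : ↥(Set.toFinite (bondsIn k (s'.Ω (k + 1))ᶜ)).toFinset => (HaarData.haar : Measure (SU N))).prod
          (Measure.pi fun _ : {b : PBond (F.P p.K) k // b ∉ (Set.toFinite (bondsIn k (s'.Ω (k + 1))ᶜ)).toFinset} => (HaarData.haar : Measure (SU N))))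
        ((Measure.pi fun _ : ↥(Set.toFinite (bondsIn k (s'.Ω (k + 1))ᶜ)).toFinset => (HaarData.haar : Measure (SU N))).prod
          (Measure.pi fun _ : {c : PBond (F.P p.K) (k + 1) // c ∉ (Set.toFinite (bondsIn (k + 1) (s'.Ω (k + 1))ᶜ)).toFinset} =>
            (HaarData.haar : Measure (SU N))))
        (fun q => (q.1, fun c : {c : PBond (F.P p.K) (k + 1) // c ∉ (Set.toFinite (bondsIn (k + 1) (s'.Ω (k + 1))ᶜ)).toFinset} =>
          (avOfRecord F N p.K k).avg
            ((MeasurableEquiv.piEquivPiSubtypeProd (fun _ : PBond (F.P p.K) k => SU N)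
              (· ∈ (Set.toFinite (bondsIn k (s'.Ω (k + 1))ᶜ)).toFinset)).symm q) c))
        ((fun U => w p g k s' U ((avOfRecord F N p.K k).avg U) *
            (chiSeqOfRecord F N ν τ.M g p.K k s'.init U * slotsOfRecord F N ν τ E w ppSel p g k s'.init U)) ∘
          ⇑(MeasurableEquiv.piEquivPiSubtypeProd (fun _ : PBond (F.P p.K) k => SU N)
            (· ∈ (Set.toFinite (bondsIn k (s'.Ω (k + 1))ᶜ)).toFinset)).symm)
      =ᵐ[(Measure.pi fun _ : ↥(Set.toFinite (bondsIn k (s'.Ω (k + 1))ᶜ)).toFinset => (HaarData.haar : Measure (SU N))).prod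
          (Measure.pi fun _ : {c : PBond (F.P p.K) (k + 1) // c ∉ (Set.toFinite (bondsIn (k + 1) (s'.Ω (k + 1))ᶜ)).toFinset} =>
            (HaarData.haar : Measure (SU N)))] Fᵢ)
    (hint : ∀ᵐ q ∂((Measure.pi fun _ : ↥(Set.toFinite (bondsIn (k + 1) (s'.Ω (k + 1))ᶜ)).toFinset => (HaarData.haar : Measure (SU N))).prod
          (Measure.pi fun _ : {c : PBond (F.P p.K) (k + 1) // c ∉ (Set.toFinite (bondsIn (k + 1) (s'.Ω (k + 1))ᶜ)).toFinset} =>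
            (HaarData.haar : Measure (SU N)))),
      ∀ S ∈ admSOfRecord F ν τ.M g p.K (k + 1) s', Integrable
        (fun y : ↥(Set.toFinite (bondsIn k (s'.Ω (k + 1))ᶜ)).toFinset → SU N =>
          zetaOp (genDataOfRecord F N V ν τ.M g p.K W s' S k).ζ
            (aOp k (genDataOfRecord F N V ν τ.M g p.K W s' S k).sA (genDataOfRecord F N V ν τ.M g p.K W s' S k).w
              (tkBranchOfRecord F N V ν τ.M g p.K W s' S k (fun ω => Φ (S, fun j => (ω j).2) (fun j => (ω j).1))))
            (Function.update (baseCfg (k + 1) ((MeasurableEquiv.piEquivPiSubtypeProd (fun _ : PBond (F.P p.K) (k + 1) => SU N)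
                (· ∈ (Set.toFinite (bondsIn (k + 1) (s'.Ω (k + 1))ᶜ)).toFinset)).symm q)) k
              (Function.updateFinset ((baseCfg (V := V) (k + 1) ((MeasurableEquiv.piEquivPiSubtypeProd (fun _ : PBond (F.P p.K) (k + 1) => SU N)
                (· ∈ (Set.toFinite (bondsIn (k + 1) (s'.Ω (k + 1))ᶜ)).toFinset)).symm q)) k).1 (Set.toFinite (bondsIn k (s'.Ω (k + 1))ᶜ)).toFinset y,
                ((baseCfg (V := V) (k + 1) ((MeasurableEquiv.piEquivPiSubtypeProd (fun _ : PBond (F.P p.K) (k + 1) => SU N)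
                  (· ∈ (Set.toFinite (bondsIn (k + 1) (s'.Ω (k + 1))ᶜ)).toFinset)).symm q)) k).2)))
        (condLaw (Measure.pi fun _ : ↥(Set.toFinite (bondsIn k (s'.Ω (k + 1))ᶜ)).toFinset => (HaarData.haar : Measure (SU N)))
          (avgRestrOfRecord F N p.K k (Set.toFinite (bondsIn k (s'.Ω (k + 1))ᶜ)).toFinset (Set.toFinite (bondsIn (k + 1) (s'.Ω (k + 1))ᶜ)).toFinset) q.1))
    (hinnerSum : ∀ᵐ q ∂((Measure.pi fun _ : ↥(Set.toFinite (bondsIn (k + 1) (s'.Ω (k + 1))ᶜ)).toFinset => (HaarData.haar : Measure (SU N))).prod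
          (Measure.pi fun _ : {c : PBond (F.P p.K) (k + 1) // c ∉ (Set.toFinite (bondsIn (k + 1) (s'.Ω (k + 1))ᶜ)).toFinset} =>
            (HaarData.haar : Measure (SU N)))),
      ∀ y : ↥(Set.toFinite (bondsIn k (s'.Ω (k + 1))ᶜ)).toFinset → SU N,
        avgRestrOfRecord F N p.K k (Set.toFinite (bondsIn k (s'.Ω (k + 1))ᶜ)).toFinset (Set.toFinite (bondsIn (k + 1) (s'.Ω (k + 1))ᶜ)).toFinset y = q.1 →
        Fᵢ (y, q.2) =
          ∑ S ∈ admSOfRecord F ν τ.M g p.K (k + 1) s', zetaOp (genDataOfRecord F N V ν τ.M g p.K W s' S k).ζ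
            (aOp k (genDataOfRecord F N V ν τ.M g p.K W s' S k).sA (genDataOfRecord F N V ν τ.M g p.K W s' S k).w
              (tkBranchOfRecord F N V ν τ.M g p.K W s' S k (fun ω => Φ (S, fun j => (ω j).2) (fun j => (ω j).1))))
            (Function.update (baseCfg (k + 1) ((MeasurableEquiv.piEquivPiSubtypeProd (fun _ : PBond (F.P p.K) (k + 1) => SU N)
                (· ∈ (Set.toFinite (bondsIn (k + 1) (s'.Ω (k + 1))ᶜ)).toFinset)).symm q)) k
              (Function.updateFinset ((baseCfg (V := V) (k + 1) ((MeasurableEquiv.piEquivPiSubtypeProd (fun _ : PBond (F.P p.K) (k + 1) => SU N)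
                (· ∈ (Set.toFinite (bondsIn (k + 1) (s'.Ω (k + 1))ᶜ)).toFinset)).symm q)) k).1 (Set.toFinite (bondsIn k (s'.Ω (k + 1))ᶜ)).toFinset y,
                ((baseCfg (V := V) (k + 1) ((MeasurableEquiv.piEquivPiSubtypeProd (fun _ : PBond (F.P p.K) (k + 1) => SU N)
                  (· ∈ (Set.toFinite (bondsIn (k + 1) (s'.Ω (k + 1))ᶜ)).toFinset)).symm q)) k).2))) :
    slotsTOfRecord F N ν τ E w ppSel p g (k + 1) s' =ᵐ[fieldMeasure (F.P p.K) (k + 1) (SU N)] TkOfRecord F N V ν τ.M g p.K W (k + 1) s' Φ :=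
  ae_eq_of_comp_glue_ae_eq p.K (k + 1) _
    (slotsTOfRecord_succ_comp_glue_ae_eq_TkOfRecord_succ ν τ E w ppSel p g hkK (hdec := hdec) hk s' W Φ hG hFm hin hint hinnerSum)

end OnTheNose

end Summit.QuantumFields.YangMills.Theorems.BalabanUVNodesN11TStepBranchSum

end
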